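import Summits.NavierStokesRegularity.NavierStokesRegularity.Theorems.PerpetualPumpAveragedTypeIBlowupAssemblyRescale
import Summits.NavierStokesRegularity.NavierStokesRegularity.Theorems.PerpetualPumpAveragedTypeIBlowupAssemblyTools
import Summits.NavierStokesRegularity.NavierStokesRegularity.Theorems.PerpetualPumpAveragedTypeIBlowupAssemblyRestart

/-!
# Crux `PerpetualPump.AveragedTypeIBlowup` (stmt-NavierStokesRegularity-1835), line `Sketch`:
# stub `handoff` — the front triple and the next bond in the slow time of the pulse

Second tools file of the proof of the registered stub `stub_handoff` (the hand-off certificate of the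
window one-step theorem; Mathlib-only mathematics).

* `handoff_residual_Icc`, `handoff_modePkg`, `handoff_sysPkg` — one mode (resp. the carrier/bond pair
  of one scale) of the critical Toda system with memory errors, given in `C¹` form on real time
  `[0, T]`, read in the slow time `σ = R_c (t − t_b)` of a clock `R_c` from a base time `t_b`
  (continuity, the derivative `κ(−x + g) + e` with `κ = R_k/R_c` and a continuous error
  `|e| ≤ η κ M` on the closed slow interval, the Duhamel restart inequality from slow time `0`);
  the registered tools sub-goal `stub_handoffSlow` is `handoff_residual_Icc`.
* `handoff_frontPkg` — the front triple `(b, w, β) = (b_n, w_n, b_{n+1}/q)` from the ignition time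
  is a forced Toda gate `b' = −b − w² + f₁`, `w' = w(b − β − 1) + f₂`, `β' = −q⁴β + w² + f₃`, the
  forcings being the residuals plus the inflow of the previous bond, the seed, and the drain into
  the next bond (the hypothesis shape of `stub_pulse`).
* `handoff_nextPkg` — the next bond `y = w_{n+1}` with its majorant in the same slow time (the
  hypothesis shape of `stub_levelOneBond`).

## References

T. Tao, *Finite time blowup for an averaged three-dimensional Navier–Stokes equation*, J. Amer.
Math. Soc. 29 (2016), §5–6 (the cascade heuristics); the content here is folklore calculus.
-/

noncomputable section

-- the summit namespace `…NavierStokesRegularity.NavierStokesRegularity…` is the tree convention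
set_option linter.dupNamespace false

open Set MeasureTheory Filter Topology intervalIntegral

namespace Summit.NavierStokesRegularity.NavierStokesRegularity.Theorems.PerpetualPumpAveragedTypeIBlowup


/-- **The residual bound extends to the closed time interval.** If `x, dx, g, M` are continuous
on `[0, T]` (`T > 0`) and `|dx − Rk(−x + g)| ≤ η Rk M` on `(0, T)`, then the same bound holds on
`[0, T]`. [folklore] -/
theorem handoff_residual_Icc {x dx g M : ℝ → ℝ} {Rk η T : ℝ} (hT : 0 < T)
    (hx : ContinuousOn x (Icc 0 T)) (hdx : ContinuousOn dx (Icc 0 T))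
    (hg : ContinuousOn g (Icc 0 T)) (hM : ContinuousOn M (Icc 0 T))
    (hode : ∀ t ∈ Ioo 0 T, |dx t - Rk * (-(x t) + g t)| ≤ η * Rk * M t) :
    ∀ t ∈ Icc 0 T, |dx t - Rk * (-(x t) + g t)| ≤ η * Rk * M t := by
  -- adapted from `preBoot_residual_Icc` (worker w-preboot, same session)
  intro t ht
  have hcl : t ∈ closure (Ioo 0 T) := by
    rw [closure_Ioo hT.ne]
    exact ht
  have hsub : Ioo 0 T ⊆ Icc 0 T := Ioo_subset_Icc_self
  have hF : ContinuousOn (fun t => |dx t - Rk * (-(x t) + g t)|) (Icc 0 T) :=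
    continuous_abs.comp_continuousOn (hdx.sub (continuousOn_const.mul (hx.neg.add hg)))
  have hG : ContinuousOn (fun t => η * Rk * M t) (Icc 0 T) := continuousOn_const.mul hM
  exact ContinuousWithinAt.closure_le hcl ((hF t ht).mono hsub) ((hG t ht).mono hsub) hode

/-- **Registered tools sub-goal `stub_handoffSlow`** of the stub `handoff` (line `Sketch`, crux
stmt-NavierStokesRegularity-1835): the residual bound of a `C¹` mode extends from the open to the
closed time interval (`handoff_residual_Icc`). [folklore] -/
theorem stub_handoffSlow :
    ∀ (x dx g M : ℝ → ℝ) (Rk η T : ℝ), 0 < T →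
      ContinuousOn x (Icc 0 T) → ContinuousOn dx (Icc 0 T) → ContinuousOn g (Icc 0 T) →
      ContinuousOn M (Icc 0 T) →
      (∀ t ∈ Ioo 0 T, |dx t - Rk * (-(x t) + g t)| ≤ η * Rk * M t) →
      ∀ t ∈ Icc 0 T, |dx t - Rk * (-(x t) + g t)| ≤ η * Rk * M t :=
  fun _ _ _ _ _ _ _ hT hx hdx hg hM hode => handoff_residual_Icc hT hx hdx hg hM hode

/-- **One mode in the slow time of a clock `Rc` from a base time `tb`**: continuity of the
rescaled mode / majorant / forcing / error, the derivative `κ(−x + g) + e` (`κ = Rk/Rc`,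
`e(σ) = (dx − Rk(−x + g))(tb + σ/Rc)/Rc`), the error bound `|e| ≤ η κ M` on the closed slow
interval, and the restart inequality of the majorant from slow time `0`. [folklore] -/
theorem handoff_modePkg {x dx g M : ℝ → ℝ} {tb Rc Rk T S θ η : ℝ}
    (hRc : 0 < Rc) (hT : 0 < T) (htb : 0 ≤ tb) (hS : 0 ≤ S) (hST : tb + S / Rc ≤ T)
    (hx : ContinuousOn x (Icc 0 T)) (hdx : ContinuousOn dx (Icc 0 T))
    (hg : ContinuousOn g (Icc 0 T)) (hM : ContinuousOn M (Icc 0 T))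
    (hode : ∀ t ∈ Ioo 0 T, HasDerivAt x (dx t) t ∧ |dx t - Rk * (-(x t) + g t)| ≤ η * Rk * M t)
    (hM0 : ∀ t ∈ Icc 0 T, 0 ≤ M t)
    (hrest : ∀ t₁ ∈ Icc 0 T, ∀ t₂ ∈ Icc t₁ T,
      M t₂ ≤ M t₁ * Real.exp (-(θ * Rk * (t₂ - t₁))) +
        Rk * ∫ u in t₁..t₂, Real.exp (-(θ * Rk * (t₂ - u))) * |g u|) :
    ContinuousOn (fun σ : ℝ => x (tb + σ / Rc)) (Icc 0 S) ∧
    ContinuousOn (fun σ : ℝ => M (tb + σ / Rc)) (Icc 0 S) ∧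
    ContinuousOn (fun σ : ℝ => g (tb + σ / Rc)) (Icc 0 S) ∧
    ContinuousOn (fun σ : ℝ =>
      (dx (tb + σ / Rc) - Rk * (-(x (tb + σ / Rc)) + g (tb + σ / Rc))) / Rc) (Icc 0 S) ∧
    (∀ σ ∈ Ioo 0 S, HasDerivAt (fun s : ℝ => x (tb + s / Rc))
      (Rk / Rc * (-(x (tb + σ / Rc)) + g (tb + σ / Rc)) +
        (dx (tb + σ / Rc) - Rk * (-(x (tb + σ / Rc)) + g (tb + σ / Rc))) / Rc) σ) ∧
    (∀ σ ∈ Icc 0 S, |(dx (tb + σ / Rc) - Rk * (-(x (tb + σ / Rc)) + g (tb + σ / Rc))) / Rc| ≤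
      η * (Rk / Rc) * M (tb + σ / Rc)) ∧
    (∀ σ ∈ Icc 0 S, 0 ≤ M (tb + σ / Rc) ∧
      M (tb + σ / Rc) ≤ M (tb + 0 / Rc) * Real.exp (-(θ * (Rk / Rc) * σ)) +
        Rk / Rc * ∫ v in (0 : ℝ)..σ, Real.exp (-(θ * (Rk / Rc) * (σ - v))) * |g (tb + v / Rc)|) := by
  -- adapted from `preBoot_modePkg` (worker w-preboot, same session)
  have hmap : ∀ σ ∈ Icc 0 S, tb + σ / Rc ∈ Icc 0 T := by
    intro σ hσ
    have h0 : 0 ≤ σ / Rc := div_nonneg hσ.1 hRc.le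
    have h1 : σ / Rc ≤ S / Rc := div_le_div_of_nonneg_right hσ.2 hRc.le
    exact ⟨by linarith, by linarith⟩
  have hg' : ContinuousOn (fun t => -(x t) + g t) (Icc 0 T) := hx.neg.add hg
  obtain ⟨hxc, hec, hder⟩ := rescale_mode (g := fun t => -(x t) + g t) hRc htb hS hST hx hdx hg'
    hM hode
  have hres := handoff_residual_Icc hT hx hdx hg hM fun t ht => (hode t ht).2
  have hφ : Continuous fun σ : ℝ => tb + σ / Rc := by fun_prop
  have hmt : MapsTo (fun σ : ℝ => tb + σ / Rc) (Icc 0 S) (Icc 0 T) := fun σ hσ => hmap σ hσ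
  refine ⟨hxc, hM.comp hφ.continuousOn hmt, hg.comp hφ.continuousOn hmt, hec,
    fun σ hσ => (hder σ hσ).1, fun σ hσ => ?_, fun σ hσ => ⟨hM0 _ (hmap σ hσ), ?_⟩⟩
  · rw [abs_div, abs_of_pos hRc, div_le_iff₀ hRc]
    calc |dx (tb + σ / Rc) - Rk * (-(x (tb + σ / Rc)) + g (tb + σ / Rc))|
        ≤ η * Rk * M (tb + σ / Rc) := hres _ (hmap σ hσ)
      _ = η * (Rk / Rc) * M (tb + σ / Rc) * Rc := by field_simp
  · have h0T : tb + 0 / Rc ∈ Icc 0 T := hmap 0 ⟨le_rfl, hS⟩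
    have h12 : tb + σ / Rc ∈ Icc (tb + 0 / Rc) T := by
      refine ⟨?_, (hmap σ hσ).2⟩
      have : 0 / Rc ≤ σ / Rc := div_le_div_of_nonneg_right hσ.1 hRc.le
      linarith
    have h := restart_rescale_mode (M := M) (G := g) (θ := θ) hRc (hrest _ h0T _ h12)
    simpa only [sub_zero] using h

/-- **Both modes `b_k`, `w_k` of one scale of THE critical system, in the slow time of a clock
`Rc` from a base time `tb`** (`handoff_modePkg` for the carrier with forcing `G0 k` and for the
bond with forcing `G1 k`). [folklore] -/
theorem handoff_sysPkg {bv wv M0 M1 db dw G0 G1 : ℤ → ℝ → ℝ} {R : ℤ → ℝ}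
    {q εb θ η T tb Rc S : ℝ} {k : ℤ}
    (hG0 : ∀ (k : ℤ) (t : ℝ), G0 k t = (wv (k - 1) t) ^ 2 / q ^ 3 - (wv k t) ^ 2 - εb * bv k t * wv k t)
    (hG1 : ∀ (k : ℤ) (t : ℝ), G1 k t = wv k t * (bv k t - bv (k + 1) t / q) + εb * (bv k t) ^ 2)
    (hcont : ∀ k : ℤ, ContinuousOn (bv k) (Icc 0 T) ∧ ContinuousOn (wv k) (Icc 0 T) ∧
      ContinuousOn (M0 k) (Icc 0 T) ∧ ContinuousOn (M1 k) (Icc 0 T))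
    (hC1 : ∀ k : ℤ, ContinuousOn (db k) (Icc 0 T) ∧ ContinuousOn (dw k) (Icc 0 T) ∧
      ∀ t ∈ Ioo 0 T, HasDerivAt (bv k) (db k t) t ∧
        |db k t - R k * (-(bv k t) + G0 k t)| ≤ η * R k * M0 k t ∧
        HasDerivAt (wv k) (dw k t) t ∧ |dw k t - R k * (-(wv k t) + G1 k t)| ≤ η * R k * M1 k t)
    (hmaj : ∀ k : ℤ, ∀ t ∈ Icc 0 T, |bv k t| ≤ M0 k t ∧ |wv k t| ≤ M1 k t ∧ 0 ≤ M0 k t ∧ 0 ≤ M1 k t)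
    (hrest : ∀ k : ℤ, ∀ t₁ ∈ Icc 0 T, ∀ t₂ ∈ Icc t₁ T,
      M0 k t₂ ≤ M0 k t₁ * Real.exp (-(θ * R k * (t₂ - t₁))) +
          R k * ∫ u in t₁..t₂, Real.exp (-(θ * R k * (t₂ - u))) * |G0 k u| ∧
        M1 k t₂ ≤ M1 k t₁ * Real.exp (-(θ * R k * (t₂ - t₁))) +
          R k * ∫ u in t₁..t₂, Real.exp (-(θ * R k * (t₂ - u))) * |G1 k u|)
    (hRc : 0 < Rc) (hT : 0 < T) (htb : 0 ≤ tb) (hS : 0 ≤ S) (hST : tb + S / Rc ≤ T) :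
    (ContinuousOn (fun σ : ℝ => bv k (tb + σ / Rc)) (Icc 0 S) ∧
      ContinuousOn (fun σ : ℝ => M0 k (tb + σ / Rc)) (Icc 0 S) ∧
      ContinuousOn (fun σ : ℝ => G0 k (tb + σ / Rc)) (Icc 0 S) ∧
      ContinuousOn (fun σ : ℝ =>
        (db k (tb + σ / Rc) - R k * (-(bv k (tb + σ / Rc)) + G0 k (tb + σ / Rc))) / Rc) (Icc 0 S) ∧
      (∀ σ ∈ Ioo 0 S, HasDerivAt (fun s : ℝ => bv k (tb + s / Rc))
        (R k / Rc * (-(bv k (tb + σ / Rc)) + G0 k (tb + σ / Rc)) +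
          (db k (tb + σ / Rc) - R k * (-(bv k (tb + σ / Rc)) + G0 k (tb + σ / Rc))) / Rc) σ) ∧
      (∀ σ ∈ Icc 0 S,
        |(db k (tb + σ / Rc) - R k * (-(bv k (tb + σ / Rc)) + G0 k (tb + σ / Rc))) / Rc| ≤
          η * (R k / Rc) * M0 k (tb + σ / Rc)) ∧
      (∀ σ ∈ Icc 0 S, 0 ≤ M0 k (tb + σ / Rc) ∧
        M0 k (tb + σ / Rc) ≤ M0 k (tb + 0 / Rc) * Real.exp (-(θ * (R k / Rc) * σ)) +
          R k / Rc * ∫ v in (0 : ℝ)..σ, Real.exp (-(θ * (R k / Rc) * (σ - v))) *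
            |G0 k (tb + v / Rc)|)) ∧
    (ContinuousOn (fun σ : ℝ => wv k (tb + σ / Rc)) (Icc 0 S) ∧
      ContinuousOn (fun σ : ℝ => M1 k (tb + σ / Rc)) (Icc 0 S) ∧
      ContinuousOn (fun σ : ℝ => G1 k (tb + σ / Rc)) (Icc 0 S) ∧
      ContinuousOn (fun σ : ℝ =>
        (dw k (tb + σ / Rc) - R k * (-(wv k (tb + σ / Rc)) + G1 k (tb + σ / Rc))) / Rc) (Icc 0 S) ∧
      (∀ σ ∈ Ioo 0 S, HasDerivAt (fun s : ℝ => wv k (tb + s / Rc))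
        (R k / Rc * (-(wv k (tb + σ / Rc)) + G1 k (tb + σ / Rc)) +
          (dw k (tb + σ / Rc) - R k * (-(wv k (tb + σ / Rc)) + G1 k (tb + σ / Rc))) / Rc) σ) ∧
      (∀ σ ∈ Icc 0 S,
        |(dw k (tb + σ / Rc) - R k * (-(wv k (tb + σ / Rc)) + G1 k (tb + σ / Rc))) / Rc| ≤
          η * (R k / Rc) * M1 k (tb + σ / Rc)) ∧
      (∀ σ ∈ Icc 0 S, 0 ≤ M1 k (tb + σ / Rc) ∧
        M1 k (tb + σ / Rc) ≤ M1 k (tb + 0 / Rc) * Real.exp (-(θ * (R k / Rc) * σ)) +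
          R k / Rc * ∫ v in (0 : ℝ)..σ, Real.exp (-(θ * (R k / Rc) * (σ - v))) *
            |G1 k (tb + v / Rc)|)) := by
  -- adapted from `preBoot_sysPkg` (worker w-preboot, same session)
  have hG0c : ContinuousOn (G0 k) (Icc 0 T) := by
    have h : ContinuousOn (fun t => (wv (k - 1) t) ^ 2 / q ^ 3 - (wv k t) ^ 2 - εb * bv k t * wv k t)
        (Icc 0 T) :=
      ((((hcont (k - 1)).2.1.pow 2).div_const _).sub ((hcont k).2.1.pow 2)).sub
        ((continuousOn_const.mul (hcont k).1).mul (hcont k).2.1)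
    exact h.congr fun t _ => hG0 k t
  have hG1c : ContinuousOn (G1 k) (Icc 0 T) := by
    have h : ContinuousOn (fun t => wv k t * (bv k t - bv (k + 1) t / q) + εb * (bv k t) ^ 2)
        (Icc 0 T) :=
      ((hcont k).2.1.mul ((hcont k).1.sub ((hcont (k + 1)).1.div_const _))).add
        (continuousOn_const.mul ((hcont k).1.pow 2))
    exact h.congr fun t _ => hG1 k t
  exact ⟨handoff_modePkg hRc hT htb hS hST (hcont k).1 (hC1 k).1 hG0c (hcont k).2.2.1
      (fun t ht => ⟨((hC1 k).2.2 t ht).1, ((hC1 k).2.2 t ht).2.1⟩) (fun t ht => (hmaj k t ht).2.2.1)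
      (fun t₁ h₁ t₂ h₂ => (hrest k t₁ h₁ t₂ h₂).1),
    handoff_modePkg hRc hT htb hS hST (hcont k).2.1 (hC1 k).2.1 hG1c (hcont k).2.2.2
      (fun t ht => ⟨((hC1 k).2.2 t ht).2.2.1, ((hC1 k).2.2 t ht).2.2.2⟩)
      (fun t ht => (hmaj k t ht).2.2.2) (fun t₁ h₁ t₂ h₂ => (hrest k t₁ h₁ t₂ h₂).2)⟩

/-- **The front triple in the slow time of the pulse is a forced Toda gate.** From the ignition time
`t_ι`, in the slow time `σ = R_n(t − t_ι)`, the triple `b = b_n`, `w = w_n`, `β = b_{n+1}/q` solves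
`b' = −b − w² + f₁`, `w' = w(b − β − 1) + f₂`, `β' = −q⁴β + w² + f₃` (`R_{n+1}/R_n = q⁴`), where, up to
the residuals (`≤ η ·` majorant), `f₁` is the inflow `w_{n-1}²/q³ − ε̄ b w`, `f₂` the seed `ε̄ b²` and
`f₃` the drain `−q³(w_{n+1}² + ε̄ b_{n+1} w_{n+1})`; everything is continuous on the closed slow
interval. [folklore] -/
theorem handoff_frontPkg {bv wv M0 M1 db dw G0 G1 : ℤ → ℝ → ℝ} {R : ℤ → ℝ}
    {q εb θ η T tι S : ℝ} {n : ℤ} {b w β f₁ f₂ f₃ : ℝ → ℝ}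
    (hG0 : ∀ (k : ℤ) (t : ℝ), G0 k t = (wv (k - 1) t) ^ 2 / q ^ 3 - (wv k t) ^ 2 - εb * bv k t * wv k t)
    (hG1 : ∀ (k : ℤ) (t : ℝ), G1 k t = wv k t * (bv k t - bv (k + 1) t / q) + εb * (bv k t) ^ 2)
    (hcont : ∀ k : ℤ, ContinuousOn (bv k) (Icc 0 T) ∧ ContinuousOn (wv k) (Icc 0 T) ∧
      ContinuousOn (M0 k) (Icc 0 T) ∧ ContinuousOn (M1 k) (Icc 0 T))
    (hC1 : ∀ k : ℤ, ContinuousOn (db k) (Icc 0 T) ∧ ContinuousOn (dw k) (Icc 0 T) ∧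
      ∀ t ∈ Ioo 0 T, HasDerivAt (bv k) (db k t) t ∧
        |db k t - R k * (-(bv k t) + G0 k t)| ≤ η * R k * M0 k t ∧
        HasDerivAt (wv k) (dw k t) t ∧ |dw k t - R k * (-(wv k t) + G1 k t)| ≤ η * R k * M1 k t)
    (hmaj : ∀ k : ℤ, ∀ t ∈ Icc 0 T, |bv k t| ≤ M0 k t ∧ |wv k t| ≤ M1 k t ∧ 0 ≤ M0 k t ∧ 0 ≤ M1 k t)
    (hrest : ∀ k : ℤ, ∀ t₁ ∈ Icc 0 T, ∀ t₂ ∈ Icc t₁ T,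
      M0 k t₂ ≤ M0 k t₁ * Real.exp (-(θ * R k * (t₂ - t₁))) +
          R k * ∫ u in t₁..t₂, Real.exp (-(θ * R k * (t₂ - u))) * |G0 k u| ∧
        M1 k t₂ ≤ M1 k t₁ * Real.exp (-(θ * R k * (t₂ - t₁))) +
          R k * ∫ u in t₁..t₂, Real.exp (-(θ * R k * (t₂ - u))) * |G1 k u|)
    (hRn : 0 < R n) (hT : 0 < T) (htι : 0 ≤ tι) (hS : 0 ≤ S) (hST : tι + S / R n ≤ T)
    (hq0 : 0 < q) (hRq : R (n + 1) / R n = q ^ 4)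
    (hb : b = fun σ => bv n (tι + σ / R n)) (hw : w = fun σ => wv n (tι + σ / R n))
    (hβ : β = fun σ => bv (n + 1) (tι + σ / R n) / q)
    (hf₁ : f₁ = fun σ => G0 n (tι + σ / R n) + (wv n (tι + σ / R n)) ^ 2 +
      (db n (tι + σ / R n) - R n * (-(bv n (tι + σ / R n)) + G0 n (tι + σ / R n))) / R n)
    (hf₂ : f₂ = fun σ => G1 n (tι + σ / R n) -
      wv n (tι + σ / R n) * (bv n (tι + σ / R n) - bv (n + 1) (tι + σ / R n) / q) +
      (dw n (tι + σ / R n) - R n * (-(wv n (tι + σ / R n)) + G1 n (tι + σ / R n))) / R n)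
    (hf₃ : f₃ = fun σ => q ^ 3 * G0 (n + 1) (tι + σ / R n) - (wv n (tι + σ / R n)) ^ 2 +
      (db (n + 1) (tι + σ / R n) -
        R (n + 1) * (-(bv (n + 1) (tι + σ / R n)) + G0 (n + 1) (tι + σ / R n))) / R n / q) :
    ContinuousOn b (Icc 0 S) ∧ ContinuousOn w (Icc 0 S) ∧ ContinuousOn β (Icc 0 S) ∧
    ContinuousOn f₁ (Icc 0 S) ∧ ContinuousOn f₂ (Icc 0 S) ∧ ContinuousOn f₃ (Icc 0 S) ∧
    (∀ σ ∈ Ioo 0 S, HasDerivAt b (-(b σ) - (w σ) ^ 2 + f₁ σ) σ) ∧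
    (∀ σ ∈ Ioo 0 S, HasDerivAt w (w σ * (b σ - β σ - 1) + f₂ σ) σ) ∧
    (∀ σ ∈ Ioo 0 S, HasDerivAt β (-(q ^ 4 * β σ) + (w σ) ^ 2 + f₃ σ) σ) ∧
    (∀ σ ∈ Icc 0 S,
      |f₁ σ - ((wv (n - 1) (tι + σ / R n)) ^ 2 / q ^ 3 -
        εb * bv n (tι + σ / R n) * wv n (tι + σ / R n))| ≤ η * M0 n (tι + σ / R n) ∧
      |f₂ σ - εb * (bv n (tι + σ / R n)) ^ 2| ≤ η * M1 n (tι + σ / R n) ∧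
      |f₃ σ + q ^ 3 * ((wv (n + 1) (tι + σ / R n)) ^ 2 +
        εb * bv (n + 1) (tι + σ / R n) * wv (n + 1) (tι + σ / R n))| ≤
        η * q ^ 3 * M0 (n + 1) (tι + σ / R n)) ∧
    (∀ σ : ℝ, b σ = bv n (tι + σ / R n) ∧ w σ = wv n (tι + σ / R n) ∧
      q * β σ = bv (n + 1) (tι + σ / R n)) := by
  obtain ⟨⟨hbc, -, hG0c, he0c, hbd, he0b, -⟩, ⟨hwc, -, hG1c, he1c, hwd, he1b, -⟩⟩ :=
    handoff_sysPkg (k := n) hG0 hG1 hcont hC1 hmaj hrest hRn hT htι hS hST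
  obtain ⟨⟨hxc, -, hG0xc, he0xc, hxd, he0xb, -⟩, -⟩ :=
    handoff_sysPkg (k := n + 1) hG0 hG1 hcont hC1 hmaj hrest hRn hT htι hS hST
  have hRR : R n / R n = 1 := div_self hRn.ne'
  have hq3 : 0 < q ^ 3 := by positivity
  have hn1 : n + 1 - 1 = n := by ring
  subst hb hw hβ hf₁ hf₂ hf₃
  refine ⟨hbc, hwc, hxc.div_const q, (hG0c.add (hwc.pow 2)).add he0c,
    (hG1c.sub (hwc.mul (hbc.sub (hxc.div_const q)))).add he1c,
    ((continuousOn_const.mul hG0xc).sub (hwc.pow 2)).add (he0xc.div_const q),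
    fun σ hσ => ?_, fun σ hσ => ?_, fun σ hσ => ?_, fun σ hσ => ⟨?_, ?_, ?_⟩,
    fun σ => ⟨rfl, rfl, mul_div_cancel₀ _ hq0.ne'⟩⟩
  · refine (hbd σ hσ).congr_deriv ?_
    rw [hRR]
    ring
  · refine (hwd σ hσ).congr_deriv ?_
    rw [hRR]
    ring
  · refine ((hxd σ hσ).div_const q).congr_deriv ?_
    rw [hRq]
    field_simp
    ring
  · have h : G0 n (tι + σ / R n) + wv n (tι + σ / R n) ^ 2 +
        (db n (tι + σ / R n) - R n * (-bv n (tι + σ / R n) + G0 n (tι + σ / R n))) / R n -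
        (wv (n - 1) (tι + σ / R n) ^ 2 / q ^ 3 - εb * bv n (tι + σ / R n) * wv n (tι + σ / R n)) =
        (db n (tι + σ / R n) - R n * (-bv n (tι + σ / R n) + G0 n (tι + σ / R n))) / R n := by
      rw [hG0 n]
      ring
    rw [h]
    simpa only [hRR, mul_one] using he0b σ hσ
  · have h : G1 n (tι + σ / R n) -
        wv n (tι + σ / R n) * (bv n (tι + σ / R n) - bv (n + 1) (tι + σ / R n) / q) +
        (dw n (tι + σ / R n) - R n * (-wv n (tι + σ / R n) + G1 n (tι + σ / R n))) / R n -
        εb * bv n (tι + σ / R n) ^ 2 =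
        (dw n (tι + σ / R n) - R n * (-wv n (tι + σ / R n) + G1 n (tι + σ / R n))) / R n := by
      rw [hG1 n]
      ring
    rw [h]
    simpa only [hRR, mul_one] using he1b σ hσ
  · have h : q ^ 3 * G0 (n + 1) (tι + σ / R n) - wv n (tι + σ / R n) ^ 2 +
        (db (n + 1) (tι + σ / R n) -
          R (n + 1) * (-bv (n + 1) (tι + σ / R n) + G0 (n + 1) (tι + σ / R n))) / R n / q +
        q ^ 3 * (wv (n + 1) (tι + σ / R n) ^ 2 +
          εb * bv (n + 1) (tι + σ / R n) * wv (n + 1) (tι + σ / R n)) =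
        (db (n + 1) (tι + σ / R n) -
          R (n + 1) * (-bv (n + 1) (tι + σ / R n) + G0 (n + 1) (tι + σ / R n))) / R n / q := by
      rw [hG0 (n + 1), hn1]
      field_simp
      ring
    rw [h, abs_div, abs_of_pos hq0, div_le_iff₀ hq0]
    calc |(db (n + 1) (tι + σ / R n) -
          R (n + 1) * (-bv (n + 1) (tι + σ / R n) + G0 (n + 1) (tι + σ / R n))) / R n|
        ≤ η * (R (n + 1) / R n) * M0 (n + 1) (tι + σ / R n) := he0xb σ hσ
      _ = η * q ^ 3 * M0 (n + 1) (tι + σ / R n) * q := by rw [hRq]; ring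

/-- **The next bond in the slow time of the pulse.** `y = w_{n+1}` solves
`y' = q⁴(y(qβ − x₂/q − 1) + ε̄ q² β²) + e_y` with `x₂ = b_{n+2}`, a continuous error
`|e_y| ≤ η q⁴ m_y` and the Duhamel restart inequality of its majorant `m_y = M1 (n+1)` at rate `θ q⁴`
from the ignition time (the hypothesis shape of `stub_levelOneBond`). [folklore] -/
theorem handoff_nextPkg {bv wv M0 M1 db dw G0 G1 : ℤ → ℝ → ℝ} {R : ℤ → ℝ}
    {q εb θ η T tι S : ℝ} {n : ℤ} {β y my x2 ey : ℝ → ℝ}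
    (hG0 : ∀ (k : ℤ) (t : ℝ), G0 k t = (wv (k - 1) t) ^ 2 / q ^ 3 - (wv k t) ^ 2 - εb * bv k t * wv k t)
    (hG1 : ∀ (k : ℤ) (t : ℝ), G1 k t = wv k t * (bv k t - bv (k + 1) t / q) + εb * (bv k t) ^ 2)
    (hcont : ∀ k : ℤ, ContinuousOn (bv k) (Icc 0 T) ∧ ContinuousOn (wv k) (Icc 0 T) ∧
      ContinuousOn (M0 k) (Icc 0 T) ∧ ContinuousOn (M1 k) (Icc 0 T))
    (hC1 : ∀ k : ℤ, ContinuousOn (db k) (Icc 0 T) ∧ ContinuousOn (dw k) (Icc 0 T) ∧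
      ∀ t ∈ Ioo 0 T, HasDerivAt (bv k) (db k t) t ∧
        |db k t - R k * (-(bv k t) + G0 k t)| ≤ η * R k * M0 k t ∧
        HasDerivAt (wv k) (dw k t) t ∧ |dw k t - R k * (-(wv k t) + G1 k t)| ≤ η * R k * M1 k t)
    (hmaj : ∀ k : ℤ, ∀ t ∈ Icc 0 T, |bv k t| ≤ M0 k t ∧ |wv k t| ≤ M1 k t ∧ 0 ≤ M0 k t ∧ 0 ≤ M1 k t)
    (hrest : ∀ k : ℤ, ∀ t₁ ∈ Icc 0 T, ∀ t₂ ∈ Icc t₁ T,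
      M0 k t₂ ≤ M0 k t₁ * Real.exp (-(θ * R k * (t₂ - t₁))) +
          R k * ∫ u in t₁..t₂, Real.exp (-(θ * R k * (t₂ - u))) * |G0 k u| ∧
        M1 k t₂ ≤ M1 k t₁ * Real.exp (-(θ * R k * (t₂ - t₁))) +
          R k * ∫ u in t₁..t₂, Real.exp (-(θ * R k * (t₂ - u))) * |G1 k u|)
    (hRn : 0 < R n) (hT : 0 < T) (htι : 0 ≤ tι) (hS : 0 ≤ S) (hST : tι + S / R n ≤ T)
    (hq0 : 0 < q) (hRq : R (n + 1) / R n = q ^ 4)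
    (hβ : β = fun σ => bv (n + 1) (tι + σ / R n) / q)
    (hy : y = fun σ => wv (n + 1) (tι + σ / R n)) (hmy : my = fun σ => M1 (n + 1) (tι + σ / R n))
    (hx2 : x2 = fun σ => bv (n + 2) (tι + σ / R n))
    (hey : ey = fun σ => (dw (n + 1) (tι + σ / R n) -
      R (n + 1) * (-(wv (n + 1) (tι + σ / R n)) + G1 (n + 1) (tι + σ / R n))) / R n) :
    ContinuousOn y (Icc 0 S) ∧ ContinuousOn my (Icc 0 S) ∧ ContinuousOn x2 (Icc 0 S) ∧
    ContinuousOn ey (Icc 0 S) ∧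
    (∀ σ ∈ Ioo 0 S, HasDerivAt y
      (q ^ 4 * (y σ * (q * β σ - x2 σ / q - 1) + εb * q ^ 2 * (β σ) ^ 2) + ey σ) σ) ∧
    (∀ σ ∈ Icc 0 S, |ey σ| ≤ η * q ^ 4 * my σ) ∧
    (∀ σ ∈ Icc 0 S, 0 ≤ my σ ∧ my σ ≤ my 0 * Real.exp (-(θ * q ^ 4 * σ)) +
      q ^ 4 * ∫ u in (0 : ℝ)..σ, Real.exp (-(θ * q ^ 4 * (σ - u))) *
        |y u * (q * β u - x2 u / q) + εb * q ^ 2 * (β u) ^ 2|) ∧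
    (∀ σ : ℝ, y σ = wv (n + 1) (tι + σ / R n) ∧ my σ = M1 (n + 1) (tι + σ / R n) ∧
      x2 σ = bv (n + 2) (tι + σ / R n)) := by
  obtain ⟨-, ⟨hyc, hM1c, -, he1c, hyd, he1b, hM1r⟩⟩ :=
    handoff_sysPkg (k := n + 1) hG0 hG1 hcont hC1 hmaj hrest hRn hT htι hS hST
  obtain ⟨⟨hx2c, -⟩, -⟩ :=
    handoff_sysPkg (k := n + 2) hG0 hG1 hcont hC1 hmaj hrest hRn hT htι hS hST
  have hn2 : n + 1 + 1 = n + 2 := by ring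
  have hG1' : ∀ σ : ℝ, G1 (n + 1) (tι + σ / R n) =
      wv (n + 1) (tι + σ / R n) * (q * (bv (n + 1) (tι + σ / R n) / q) - bv (n + 2) (tι + σ / R n) / q) +
        εb * q ^ 2 * (bv (n + 1) (tι + σ / R n) / q) ^ 2 := by
    intro σ
    rw [hG1 (n + 1), hn2]
    field_simp
  subst hβ hy hmy hx2 hey
  refine ⟨hyc, hM1c, hx2c, he1c, fun σ hσ => ?_, fun σ hσ => ?_, fun σ hσ => ?_,
    fun σ => ⟨rfl, rfl, rfl⟩⟩
  · refine (hyd σ hσ).congr_deriv ?_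
    beta_reduce
    rw [hRq, hG1' σ]
    ring
  · simpa only [hRq] using he1b σ hσ
  · obtain ⟨h0, h1⟩ := hM1r σ hσ
    refine ⟨h0, ?_⟩
    rw [hRq] at h1
    have hint : ∫ v in (0 : ℝ)..σ, Real.exp (-(θ * q ^ 4 * (σ - v))) * |G1 (n + 1) (tι + v / R n)| =
        ∫ u in (0 : ℝ)..σ, Real.exp (-(θ * q ^ 4 * (σ - u))) *
          |wv (n + 1) (tι + u / R n) * (q * (bv (n + 1) (tι + u / R n) / q) - bv (n + 2) (tι + u / R n) / q) +
            εb * q ^ 2 * (bv (n + 1) (tι + u / R n) / q) ^ 2| :=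
      intervalIntegral.integral_congr fun v _ => by simp only [hG1' v]
    rw [hint] at h1
    simpa only [zero_div, add_zero] using h1

end Summit.NavierStokesRegularity.NavierStokesRegularity.Theorems.PerpetualPumpAveragedTypeIBlowup

end
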